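import Literature.MathematicalPhysics.QuantumFieldTheory.Balaban1983to89.B8Eq191FlatStencils
import Literature.MathematicalPhysics.QuantumFieldTheory.Balaban1983to89.B9Eq316TowerFlatIsOneStep
import Literature.MathematicalPhysics.QuantumFieldTheory.Balaban1983to89.B8ScaledSupNorm
import Literature.MathematicalPhysics.QuantumFieldTheory.Balaban1983to89.B8Eq184Proof
import Literature.MathematicalPhysics.QuantumFieldTheory.Balaban1983to89.B8Eq140Level
import Literature.MathematicalPhysics.QuantumFieldTheory.Balaban1983to89.B7BlockAvgLog

/-!
# `Balaban1983to89.B8Ineq159FlatMaps` — [Balaban1985RegularSpaces] p. 86 / [Balaban1985BackgroundPropagators] p. 394 «⊗ identity» AT THE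
# FLAT BACKGROUND `U₀ = 1`: every stencil of Theorem 4's (1.59) clause — `D^η_1`, `D^{η*}_1`, the plaquette derivative (3.4), the current
# `J = D^{η*}_1D^η_1A` (1.55), `Δ^η_1`, the transposes `Q′(1)ᵀ` of (1.38), the linearised averages `Q_j(1)` of [B7] (127) — COMMUTES with
# every continuous `ℂ`-linear map `φ : 𝔸 →L[ℂ] 𝔹`; the flat Landau condition (1.38) passes to `φ ∘ A`; `(iη)⁻¹ log e^{iηA′} = A′`; crude bounds

statement-level skeleton of published theorems with citation tags; proofs where landed; nothing here is a claim about the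
Yang–Mills mass gap

`[Balaban1985RegularSpaces]` ("B8", CMP **99** (1985) 75–102) (1.1)–(1.2) p. 76, (1.36)–(1.38) p. 82, (1.55) p. 86, (1.69) p. 88; [4] =
`[Balaban1985BackgroundPropagators]` (CMP **99** (1985) 389–434) (3.4) p. 391, (3.23)–(3.25) p. 394, p. 394 («⊗ id»: the operators on
`𝔤`-valued functions *"are of the form … ⊗ identity"*); [B7] = `[Balaban1985Averaging]` (125) p. 36, (127) p. 37.
PDF held: `paper:balaban1985-cmp99-regular-spaces-gauge-fixing` (journal page = PDF page + 74).

CITATION HEADER (lean-in-tree rule).  Cell `pub-ymgap` (YM Track A, HUMAN RULING D-0062), DAG node N05 = [B8], seat `pub-ymgap-dag-n05-e` (g5;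
director-ym R141 (C), FAN-OUT §N05 row s3b — THE FLAT CURRENCY for Proposition 6).  The algebraic half of the `⊗ id` reduction used by the
companion `B8Ineq159FlatOfScalar` (★ `flat159_clause_of_scalar`: Theorem 4's two-member (1.59) clause at background `1` for `𝔸`-valued
exponents from the SCALAR flat clause).  §1 MAPS: for `φ : 𝔸 →L[ℂ] 𝔹` and the flat background, `φ ∘ (stencil) = (stencil) ∘ φ` for
`covDerivFwd`, `covDeriv`, `plaqCovDeriv`, `pdiv`, `Jcur`, `covDivB`, `covLap`, `QT` (on g3's flat forms `B8Eq191FlatStencils`), hence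
`IsLandau138 … 1 A → IsLandau138 … 1 (φ ∘ A)` (multiplier `φ ∘ μ`); for `linQ`/`linQIter` and — for bounded fields, via
`B9Eq316TowerFlatIsOneStep.linCovIter_one_left` — `linCovIter L 1`; and `logCfg η W = A′` wherever `W = cfgExp η A′` with `η‖A′‖ ≤ 1/2`
(`B7BlockAvgLog.mlog_exp`, `1/2 < log 2`).  §2 BOUNDS: uniform bounds of `D^η_1F`, `D^{η*}_1F`, `(D^η_1A)(p)`, `J(A)` from `‖A‖ ≤ M` (the
`Bdd` side conditions of the p. 86 suprema; sizes immaterial).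

HONEST SCOPE.  Finite real-linear combinations of point values and `log ∘ exp = id`; nothing of [4]'s estimates.  Count-neutral; N05 NOT
discharged; one finite `T⁴` programme at fixed `ε`, Bałaban as printed; nothing continuum ∕ ℝ⁴ ∕ OS ∕ mass-gap ∕ Clay.  No `sorry`, no `def`,
no `instance`, no `notation`.  Unit `pub-ymgap-dag-n05-e` (g5), 2026-08-27.
-/

noncomputable section

namespace Literature.MathematicalPhysics.QuantumFieldTheory.Balaban1983to89.B8Ineq159FlatMaps

open NormedSpace Finset
open Complex (I I_ne_zero)
open B7Prop1Explicit (e expUnit val_expUnit asum_seg_natCast boxVec seg)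
open B7Eq78Linearization (conjR conjR_apply)
open B8Ineq132 (covDeriv covDerivFwd BondTouches)
open B8Eq143PlaqExpansion (pdiv)
open B8Eq146AExpansion (plaqCovDeriv plaqCovDeriv_eq_covDerivFwd iEta)
open B8Eq155JBound (Jcur wsup wsup_le le_wsup wsup_nonneg)
open B8ScaledSupNorm (weight msup Bdd bondNorm msup_le msup_nonneg weight_mul_norm_le_msup weight_neg_natCast weight_pos)
open B8Eq138LandauZd (covDivB covLap QT IsLandau138 IsLandau138W logCfg isLandau138_congr)
open B8Eq184Proof (cfgExp)
open B8Eq140Level (SideTouches sideTouches_of_bondTouches)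
open B7Prop4GeneralLevels (linCovIter)
open B7Prop3Flat (linQ)
open B7Prop4Flat (linQIter linQIter_zero linQIter_succ norm_linQIter_le)
open B9Eq316TowerFlatIsOneStep (linCovIter_one_left)
open B8Eq191FlatStencils (covDerivFwd_flat_apply covDeriv_flat_apply covLap_flat_apply QT_flat_apply)
open B7BlockAvgLog (mlog_exp)
open MatrixLog (mlog)

export B7Prop1Explicit (Site)

variable {d : ℕ}

/-! ## §1 The flat stencils commute with continuous `ℂ`-linear maps ([4] p. 394 «⊗ identity») -/

section Maps

variable {𝔸 : Type*} [NormedRing 𝔸] [NormedAlgebra ℂ 𝔸] [CompleteSpace 𝔸]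
variable {𝔹 : Type*} [NormedRing 𝔹] [NormedAlgebra ℂ 𝔹] [CompleteSpace 𝔹]

omit [CompleteSpace 𝔸] [CompleteSpace 𝔹] in
/-- `φ` commutes with the flat forward derivative (1.1)₁: `φ((D^η_{1,μ}F)(x)) = (D^η_{1,μ}(φ∘F))(x)`.
[cite: Balaban1985RegularSpaces, (1.1) p.76; Balaban1985BackgroundPropagators, p.394 («⊗ identity»)] -/
theorem map_covDerivFwd_flat (φ : 𝔸 →L[ℂ] 𝔹) (η : ℝ) (μ : Fin d) (F : Site d → 𝔸) (x : Site d) :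
    φ (covDerivFwd η (1 : Site d → Fin d → 𝔸ˣ) μ F x) = covDerivFwd η (1 : Site d → Fin d → 𝔹ˣ) μ (fun z => φ (F z)) x := by
  rw [covDerivFwd_flat_apply, covDerivFwd_flat_apply, φ.map_smul_of_tower, map_sub]

omit [CompleteSpace 𝔸] [CompleteSpace 𝔹] in
/-- `φ` commutes with the flat backward derivative (1.1)₂. [cite: Balaban1985RegularSpaces, (1.1) p.76; Balaban1985BackgroundPropagators, p.394] -/
theorem map_covDeriv_flat (φ : 𝔸 →L[ℂ] 𝔹) (η : ℝ) (ν : Fin d) (F : Site d → 𝔸) (x : Site d) :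
    φ (covDeriv η (1 : Site d → Fin d → 𝔸ˣ) ν F x) = covDeriv η (1 : Site d → Fin d → 𝔹ˣ) ν (fun z => φ (F z)) x := by
  rw [covDeriv_flat_apply, covDeriv_flat_apply, φ.map_smul_of_tower, map_sub]

omit [CompleteSpace 𝔸] [CompleteSpace 𝔹] in
/-- `φ` commutes with the flat plaquette derivative [4] (3.4) `(D^η_1A)(p_{μν}(x)) = (D^η_{1,μ}A_ν)(x) − (D^η_{1,ν}A_μ)(x)`.
[cite: Balaban1985BackgroundPropagators, (3.4) p.391, p.394] -/
theorem map_plaqCovDeriv_flat (φ : 𝔸 →L[ℂ] 𝔹) (η : ℝ) (A : Site d → Fin d → 𝔸) (μ ν : Fin d) (x : Site d) :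
    φ (plaqCovDeriv η (1 : Site d → Fin d → 𝔸ˣ) A μ ν x) =
      plaqCovDeriv η (1 : Site d → Fin d → 𝔹ˣ) (fun z κ => φ (A z κ)) μ ν x := by
  rw [plaqCovDeriv_eq_covDerivFwd, plaqCovDeriv_eq_covDerivFwd, map_sub, map_covDerivFwd_flat, map_covDerivFwd_flat]

omit [CompleteSpace 𝔸] [CompleteSpace 𝔹] in
/-- `φ` commutes with the flat divergence (1.2) of a plaquette field. [cite: Balaban1985RegularSpaces, (1.2) p.76; Balaban1985BackgroundPropagators, p.394] -/
theorem map_pdiv_flat (φ : 𝔸 →L[ℂ] 𝔹) (η : ℝ) (F : Fin d → Fin d → Site d → 𝔸) (μ : Fin d) (x : Site d) :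
    φ (pdiv η (1 : Site d → Fin d → 𝔸ˣ) F μ x) = pdiv η (1 : Site d → Fin d → 𝔹ˣ) (fun κ ν z => φ (F κ ν z)) μ x := by
  unfold pdiv
  rw [map_sub, map_sum, map_sum]
  simp only [map_covDeriv_flat]

omit [CompleteSpace 𝔸] [CompleteSpace 𝔹] in
/-- **`φ` commutes with the flat current (1.55) `J = D^{η*}_1D^η_1A`**: `φ(J(A)_μ(x)) = J(φ∘A)_μ(x)`.
[cite: Balaban1985RegularSpaces, (1.55) p.86; Balaban1985BackgroundPropagators, p.394 («⊗ identity»)] -/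
theorem map_Jcur_flat (φ : 𝔸 →L[ℂ] 𝔹) (η : ℝ) (A : Site d → Fin d → 𝔸) (μ : Fin d) (x : Site d) :
    φ (Jcur η (1 : Site d → Fin d → 𝔸ˣ) A μ x) = Jcur η (1 : Site d → Fin d → 𝔹ˣ) (fun z κ => φ (A z κ)) μ x := by
  unfold Jcur
  rw [map_pdiv_flat]
  congr 1
  funext κ ν z
  exact map_plaqCovDeriv_flat φ η A κ ν z

omit [CompleteSpace 𝔸] [CompleteSpace 𝔹] in
/-- `φ` commutes with the flat divergence `D^{η*}_1` of a bond field. [cite: Balaban1985RegularSpaces, (1.38) p.82; Balaban1985BackgroundPropagators, p.394] -/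
theorem map_covDivB_flat (φ : 𝔸 →L[ℂ] 𝔹) (η : ℝ) (A : Site d → Fin d → 𝔸) (x : Site d) :
    φ (covDivB η (1 : Site d → Fin d → 𝔸ˣ) A x) = covDivB η (1 : Site d → Fin d → 𝔹ˣ) (fun z κ => φ (A z κ)) x := by
  unfold covDivB
  rw [map_sum]
  simp only [map_covDeriv_flat]

omit [CompleteSpace 𝔸] [CompleteSpace 𝔹] in
/-- `φ` commutes with zero-extension (the Dirichlet convention). [folklore] [cite: Balaban1985BackgroundPropagators, (3.24) p.394] -/
theorem map_indicator (φ : 𝔸 →L[ℂ] 𝔹) (S : Set (Site d)) (g : Site d → 𝔸) (x : Site d) :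
    φ (S.indicator g x) = S.indicator (fun z => φ (g z)) x := by
  classical
  by_cases hx : x ∈ S
  · rw [Set.indicator_of_mem hx, Set.indicator_of_mem hx]
  · rw [Set.indicator_of_notMem hx, Set.indicator_of_notMem hx, map_zero]

omit [CompleteSpace 𝔸] [CompleteSpace 𝔹] in
/-- `φ` commutes with the flat Laplacian [4] (3.23). [cite: Balaban1985BackgroundPropagators, (3.23) p.394] -/
theorem map_covLap_flat (φ : 𝔸 →L[ℂ] 𝔹) (η : ℝ) (g : Site d → 𝔸) (x : Site d) :
    φ (covLap η (1 : Site d → Fin d → 𝔸ˣ) g x) = covLap η (1 : Site d → Fin d → 𝔹ˣ) (fun z => φ (g z)) x := by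
  rw [covLap_flat_apply, covLap_flat_apply, map_sum]
  refine Finset.sum_congr rfl fun μ _ => ?_
  rw [φ.map_smul_of_tower, map_sub, map_sub, φ.map_smul_of_tower]

omit [CompleteSpace 𝔸] [CompleteSpace 𝔹] in
/-- `φ` commutes with the Dirichlet flat Laplacian of the flat divergence — the left side of the multiplier form of (1.38).
[cite: Balaban1985RegularSpaces, (1.38) p.82; Balaban1985BackgroundPropagators, (3.23)–(3.25) p.394] -/
theorem map_covLap_indicator_covDivB_flat (φ : 𝔸 →L[ℂ] 𝔹) (η : ℝ) (Ω₀ : Set (Site d)) (A : Site d → Fin d → 𝔸) (x : Site d) :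
    φ (covLap η (1 : Site d → Fin d → 𝔸ˣ) (Ω₀.indicator (covDivB η (1 : Site d → Fin d → 𝔸ˣ) A)) x) =
      covLap η (1 : Site d → Fin d → 𝔹ˣ) (Ω₀.indicator (covDivB η (1 : Site d → Fin d → 𝔹ˣ) (fun z κ => φ (A z κ)))) x := by
  rw [map_covLap_flat]
  congr 1
  funext z
  rw [map_indicator]
  congr 1
  funext w
  exact map_covDivB_flat φ η A w

/-- `φ` commutes with the flat transpose `Q′(1)ᵀ` on multipliers — the right side of the multiplier form of (1.38).
[cite: Balaban1985RegularSpaces, (1.29) p.81, (1.38) p.82; Balaban1985BackgroundPropagators, (3.24) p.394] -/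
theorem map_QT_flat (φ : 𝔸 →L[ℂ] 𝔹) (L m : ℕ) (Λs : ℕ → Set (Site d)) (μ : ℕ → Site d → 𝔸) (x : Site d) :
    φ (QT L m Λs (1 : Site d → Fin d → 𝔸ˣ) μ x) = QT L m Λs (1 : Site d → Fin d → 𝔹ˣ) (fun j z => φ (μ j z)) x := by
  rw [QT_flat_apply, QT_flat_apply, map_sum]
  refine Finset.sum_congr rfl fun j _ => ?_
  rw [φ.map_smul_of_tower, map_indicator]

/-- **The flat Landau condition (1.38) is preserved by `φ`**: `R(1)D^{η*}_1A = 0` (multiplier form) for `A` gives it for `φ ∘ A`, with the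
multiplier `φ ∘ μ`. [cite: Balaban1985RegularSpaces, (1.38) p.82; Balaban1985BackgroundPropagators, (3.25) p.394, p.394 («⊗ identity»)] -/
theorem isLandau138_map_flat (φ : 𝔸 →L[ℂ] 𝔹) {L m : ℕ} {η : ℝ} {Ω₀ : Set (Site d)} {Λs : ℕ → Set (Site d)}
    {A : Site d → Fin d → 𝔸} (h : IsLandau138 L m η Ω₀ Λs (1 : Site d → Fin d → 𝔸ˣ) A) :
    IsLandau138 L m η Ω₀ Λs (1 : Site d → Fin d → 𝔹ˣ) (fun z κ => φ (A z κ)) := by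
  obtain ⟨μ, hμ⟩ := h
  refine ⟨fun j z => φ (μ j z), fun x hx => ?_⟩
  rw [← map_covLap_indicator_covDivB_flat, ← map_QT_flat, hμ x hx]

omit [CompleteSpace 𝔸] [CompleteSpace 𝔹] in
/-- `φ` commutes with the flat one-step linearised average (125) `(Q₀A)_c = Σ_{x∈B(c₋)} L^{−d} A([x, x + Le_κ])`.
[cite: Balaban1985Averaging, (125) p.36] -/
theorem map_linQ (φ : 𝔸 →L[ℂ] 𝔹) (L : ℕ) (A : Site d → Fin d → 𝔸) (q : Site d) (κ : Fin d) :
    φ (linQ L A q κ) = linQ L (fun z ν => φ (A z ν)) q κ := by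
  unfold linQ
  rw [map_sum]
  refine Finset.sum_congr rfl fun r _ => ?_
  rw [φ.map_smul_of_tower, asum_seg_natCast, asum_seg_natCast, map_sum]

omit [CompleteSpace 𝔸] [CompleteSpace 𝔹] in
/-- `φ` commutes with the flat composite (127) `Q_j(1)` (`linQIter`). [cite: Balaban1985Averaging, (127) p.37] -/
theorem map_linQIter (φ : 𝔸 →L[ℂ] 𝔹) (L : ℕ) (A : Site d → Fin d → 𝔸) :
    ∀ (j : ℕ) (z : Site d) (κ : Fin d), φ (linQIter L A j z κ) = linQIter L (fun w ν => φ (A w ν)) j z κ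
  | 0, z, κ => by simp
  | j + 1, z, κ => by
    rw [linQIter_succ, linQIter_succ, map_linQ]
    congr 1
    funext w ν
    exact map_linQIter φ L A j w ν

/-- **`φ` commutes with the linearised covariant averages `Q_j(U₀)` AT `U₀ = 1`** for a bounded field (`B9Eq316TowerFlatIsOneStep.linCovIter_one_left`:
at the flat background the composite (127) is the flat one). [cite: Balaban1985Averaging, (127) p.37, (125) p.36; Balaban1985BackgroundPropagators, p.394] -/
theorem map_linCovIter_flat [NormOneClass 𝔸] [NormOneClass 𝔹] (φ : 𝔸 →L[ℂ] 𝔹) {L : ℕ} (hL : 1 ≤ L) (A : Site d → Fin d → 𝔸)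
    {b : ℝ} (hb : 0 ≤ b) (hA : ∀ z κ, ‖A z κ‖ ≤ b) (j : ℕ) (z : Site d) (κ : Fin d) :
    φ (linCovIter L (1 : Site d → Fin d → 𝔸ˣ) A j z κ) = linCovIter L (1 : Site d → Fin d → 𝔹ˣ) (fun w ν => φ (A w ν)) j z κ := by
  have hφA : ∀ w ν, ‖φ (A w ν)‖ ≤ ‖φ‖ * b := fun w ν => (φ.le_opNorm _).trans (mul_le_mul_of_nonneg_left (hA w ν) (norm_nonneg _))
  rw [linCovIter_one_left L hL A hb hA j, linCovIter_one_left L hL _ (by positivity) hφA j, map_linQIter]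

/-- **The exponent of record is `A′`**: if `W(b) = e^{iηA′(b)}` and `η‖A′(b)‖ ≤ 1/2` then `(iη)⁻¹ log W(b) = A′(b)` (`log ∘ exp = id` below
`log 2`, `B7BlockAvgLog.mlog_exp`). [cite: Balaban1985RegularSpaces, (1.36) p.82, (1.69) p.88] -/
theorem logCfg_eq_of_cfgExp [NormOneClass 𝔸] {η : ℝ} (hη : 0 < η) {W : Site d → Fin d → 𝔸ˣ} {A' : Site d → Fin d → 𝔸} {y : Site d}
    {τ : Fin d} (hW : W y τ = cfgExp η A' y τ) (hsmall : η * ‖A' y τ‖ ≤ 1 / 2) : logCfg η W y τ = A' y τ := by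
  unfold logCfg
  rw [hW, cfgExp, val_expUnit]
  have hn : ‖(I : ℂ) • (η • A' y τ)‖ < Real.log 2 := by
    rw [norm_smul, Complex.norm_I, one_mul, norm_smul, Real.norm_of_nonneg hη.le]
    have h2 : (1 : ℝ) / 2 < Real.log 2 := by
      have := Real.log_two_gt_d9
      linarith
    exact lt_of_le_of_lt hsmall h2
  rw [mlog_exp hn, smul_smul, inv_mul_cancel₀ I_ne_zero, one_smul, smul_smul, inv_mul_cancel₀ hη.ne', one_smul]

end Maps

/-! ## §2 Crude bounds: the `Bdd` side conditions of the p. 86 suprema from a uniform bound on the field -/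

section Bounds

variable {𝔸 : Type*} [NormedRing 𝔸] [NormedAlgebra ℂ 𝔸]

/-- `‖(D^η_{1,μ}F)(x)‖ ≤ η⁻¹(M + M)` for `‖F‖ ≤ M`. [cite: Balaban1985RegularSpaces, (1.1) p.76] -/
theorem norm_covDerivFwd_flat_le {η : ℝ} (hη : 0 < η) {F : Site d → 𝔸} {M : ℝ} (hF : ∀ z, ‖F z‖ ≤ M) (μ : Fin d) (x : Site d) :
    ‖covDerivFwd η (1 : Site d → Fin d → 𝔸ˣ) μ F x‖ ≤ η⁻¹ * (M + M) := by
  rw [covDerivFwd_flat_apply, norm_smul, Real.norm_of_nonneg (inv_nonneg.2 hη.le)]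
  exact mul_le_mul_of_nonneg_left ((norm_sub_le _ _).trans (add_le_add (hF _) (hF _))) (inv_nonneg.2 hη.le)

/-- `‖(D^{η*}_{1,ν}F)(x)‖ ≤ η⁻¹(M + M)` for `‖F‖ ≤ M`. [cite: Balaban1985RegularSpaces, (1.1) p.76] -/
theorem norm_covDeriv_flat_le {η : ℝ} (hη : 0 < η) {F : Site d → 𝔸} {M : ℝ} (hF : ∀ z, ‖F z‖ ≤ M) (ν : Fin d) (x : Site d) :
    ‖covDeriv η (1 : Site d → Fin d → 𝔸ˣ) ν F x‖ ≤ η⁻¹ * (M + M) := by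
  rw [covDeriv_flat_apply, norm_smul, Real.norm_of_nonneg (inv_nonneg.2 hη.le)]
  exact mul_le_mul_of_nonneg_left ((norm_sub_le _ _).trans (add_le_add (hF _) (hF _))) (inv_nonneg.2 hη.le)

/-- `‖(D^η_1A)(p)‖ ≤ 2η⁻¹(M + M)` for `‖A‖ ≤ M`. [cite: Balaban1985BackgroundPropagators, (3.4) p.391] -/
theorem norm_plaqCovDeriv_flat_le {η : ℝ} (hη : 0 < η) {A : Site d → Fin d → 𝔸} {M : ℝ} (hA : ∀ z κ, ‖A z κ‖ ≤ M)
    (μ ν : Fin d) (x : Site d) :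
    ‖plaqCovDeriv η (1 : Site d → Fin d → 𝔸ˣ) A μ ν x‖ ≤ η⁻¹ * (M + M) + η⁻¹ * (M + M) := by
  rw [plaqCovDeriv_eq_covDerivFwd]
  exact (norm_sub_le _ _).trans
    (add_le_add (norm_covDerivFwd_flat_le hη (fun z => hA z ν) μ x) (norm_covDerivFwd_flat_le hη (fun z => hA z μ) ν x))

/-- **A crude uniform bound on the flat current (1.55)** from `‖A‖ ≤ M`: `‖J(A)_μ(x)‖ ≤ 2d·η⁻¹·2·(2η⁻¹(M + M))` (existence of a
bound is what the p. 86 suprema need; its size is immaterial). [cite: Balaban1985RegularSpaces, (1.55) p.86] -/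
theorem norm_Jcur_flat_le {η : ℝ} (hη : 0 < η) {A : Site d → Fin d → 𝔸} {M : ℝ} (hM : 0 ≤ M) (hA : ∀ z κ, ‖A z κ‖ ≤ M)
    (μ : Fin d) (x : Site d) :
    ‖Jcur η (1 : Site d → Fin d → 𝔸ˣ) A μ x‖ ≤
      (d : ℝ) * (η⁻¹ * ((η⁻¹ * (M + M) + η⁻¹ * (M + M)) + (η⁻¹ * (M + M) + η⁻¹ * (M + M)))) +
      (d : ℝ) * (η⁻¹ * ((η⁻¹ * (M + M) + η⁻¹ * (M + M)) + (η⁻¹ * (M + M) + η⁻¹ * (M + M)))) := by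
  have hP : ∀ κ ν z, ‖plaqCovDeriv η (1 : Site d → Fin d → 𝔸ˣ) A κ ν z‖ ≤ η⁻¹ * (M + M) + η⁻¹ * (M + M) :=
    fun κ ν z => norm_plaqCovDeriv_flat_le hη hA κ ν z
  have hT : ∀ ν κ κ', ‖covDeriv η (1 : Site d → Fin d → 𝔸ˣ) ν (plaqCovDeriv η (1 : Site d → Fin d → 𝔸ˣ) A κ κ') x‖ ≤
      η⁻¹ * ((η⁻¹ * (M + M) + η⁻¹ * (M + M)) + (η⁻¹ * (M + M) + η⁻¹ * (M + M))) :=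
    fun ν κ κ' => norm_covDeriv_flat_le hη (fun z => hP κ κ' z) ν x
  have h0 : 0 ≤ η⁻¹ * ((η⁻¹ * (M + M) + η⁻¹ * (M + M)) + (η⁻¹ * (M + M) + η⁻¹ * (M + M))) := by positivity
  have hcard : ∀ s : Finset (Fin d), (s.card : ℝ) ≤ d := fun s => by
    exact_mod_cast (Finset.card_le_univ s).trans_eq (Fintype.card_fin d)
  have hsum : ∀ (s : Finset (Fin d)) (g : Fin d → 𝔸),
      (∀ ν, ‖g ν‖ ≤ η⁻¹ * ((η⁻¹ * (M + M) + η⁻¹ * (M + M)) + (η⁻¹ * (M + M) + η⁻¹ * (M + M)))) →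
      ‖∑ ν ∈ s, g ν‖ ≤ (d : ℝ) * (η⁻¹ * ((η⁻¹ * (M + M) + η⁻¹ * (M + M)) + (η⁻¹ * (M + M) + η⁻¹ * (M + M)))) := by
    intro s g hg
    refine (norm_sum_le _ _).trans ?_
    calc ∑ ν ∈ s, ‖g ν‖ ≤ ∑ ν ∈ s, η⁻¹ * ((η⁻¹ * (M + M) + η⁻¹ * (M + M)) + (η⁻¹ * (M + M) + η⁻¹ * (M + M))) :=
          Finset.sum_le_sum fun ν _ => hg ν
      _ = (s.card : ℝ) * (η⁻¹ * ((η⁻¹ * (M + M) + η⁻¹ * (M + M)) + (η⁻¹ * (M + M) + η⁻¹ * (M + M)))) := by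
          rw [Finset.sum_const, nsmul_eq_mul]
      _ ≤ (d : ℝ) * (η⁻¹ * ((η⁻¹ * (M + M) + η⁻¹ * (M + M)) + (η⁻¹ * (M + M) + η⁻¹ * (M + M)))) :=
          mul_le_mul_of_nonneg_right (hcard s) h0
  unfold Jcur pdiv
  exact (norm_sub_le _ _).trans (add_le_add (hsum _ _ fun ν => hT ν ν μ) (hsum _ _ fun ν => hT ν μ ν))

end Bounds

end Literature.MathematicalPhysics.QuantumFieldTheory.Balaban1983to89.B8Ineq159FlatMaps

end
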